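import Summits.AtomisticToContinuum.FouriersLaw.Theses.HonestZwanzig

/-!
# OrthogonalOhm — STRATEGY CENSUS, typed companion (crux-strategist s2, 2026-08-17)

Crux item `stmt-AtomisticToContinuum-12693` (`HonestZwanzig.OrthogonalOhm`, route `HonestZwanzig`, sub-problem
`FouriersLaw`).  Companion to `Cruxes/OrthogonalOhm/STRATEGY-CENSUS.md`: the signatures quoted there under
`## Strengthen` and `## Decomposition`, typed over the crux's byte-identical `let`-gadgets so that they elaborate,
plus the one piece of bookkeeping that the "strengthen-to-induct" switch S⁺₁ would contribute, PROVED
(`abs_le_of_dyadic_modulus`, `bondBound_of_unitFrequency_of_modulus`).  Nothing here is a registered line: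
the census explains why each switch leaves the `N`-uniform zero-frequency core (⊇ `HasBoundedResponse`) intact.

* `UniformSchurModulus` (S⁺₁) — an `N`-uniform Hölder modulus of the orthogonal bond response at zero
  frequency; with `UnitFrequencyBound` it gives the boundedness half of the lead's stub U1 in ANY-limit form
  (`BondBoundAnyLimit`) by dyadic telescoping — `bondBound_of_unitFrequency_of_modulus`.
* `SchurBulkLimitAtFixedFrequency` — the fixed-frequency thermodynamic-limit piece of the regime split D4.
* `ExponentialClampedLocality` (S⁺₂) — exponential locality of the clamped kernel (predicted FALSE: `z⁻²` tails).
* `ShadowConcentration` — the one-profile piece of the Ward-dissolution split D2 (`a_N = G(0)⁻¹ lap₀(e, J)`).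
-/

namespace Summit.AtomisticToContinuum.FouriersLaw.Cruxes.OrthogonalOhm.StrategyCensus

open MeasureTheory Filter Topology

/-- **S⁺₁ `UniformSchurModulus`.**  There are `C` and `θ > 0` such that for all `N ≥ 2`, every bond `b` and every
`s ∈ (0, 1]`: `|schur_{s/2}(j_b, J) − schur_s(j_b, J)| ≤ C·s^θ` — the orthogonal DC response is reached with an
`N`-uniform power-law modulus (MCT predicts `θ = 1/2` for the clamped kernel of a diffusive chain; the velocity-flip
anchor j015200 shows `ρ_mid(s)` identical for `N = 16…64` at every `s`). Strictly stronger than the boundedness and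
existence content of U1. -/
def UniformSchurModulus : Prop :=
  ∀ ω₂ lam β γ : ℝ, 0 < ω₂ → 0 < lam → 0 < β → 0 < γ → ∀ T : ℝ, 0 < T → ∃ C θ : ℝ, 0 < θ ∧ ∀ N : ℕ, 2 ≤ N → let P := Literature.MathematicalPhysics.KineticTheory.HeatConduction.pinnedChain ω₂ lam β γ; let X := Literature.MathematicalPhysics.KineticTheory.HeatConduction.PhaseSpace N; let μ : MeasureTheory.Measure X := P.gibbsMeasure N T; let corr : (X → ℝ) → (X → ℝ) → ℝ → ℝ := fun f g t => (∫ z, f z * (∫ y, g y ∂(P.transitionKernel N T T t.toNNReal z)) ∂μ) - (∫ z, f z ∂μ) * (∫ z, g z ∂μ); let lap : ℝ → (X → ℝ) → (X → ℝ) → ℝ := fun s f g => ∫ t in Set.Ioi (0 : ℝ), Real.exp (-(s * t)) * corr f g t; let e : Fin N → X → ℝ := fun x z => z.2 x ^ 2 / 2 + P.U (z.1 x) + ∑ j : Fin N, ((if j.val = x.val + 1 then P.V (z.1 j - z.1 x) / 2 else 0) + (if x.val = j.val + 1 then P.V (z.1 x - z.1 j) / 2 else 0)); let G : ℝ → Matrix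 (Fin N) (Fin N) ℝ := fun s => Matrix.of fun x y => lap s (e x) (e y); let schur : ℝ → (X → ℝ) → (X → ℝ) → ℝ := fun s f g => lap s f g - ∑ x : Fin N, ∑ y : Fin N, lap s f (e x) * (G s)⁻¹ x y * lap s (e y) g; let J : X → ℝ := fun z => ∑ i : Fin N, P.bondCurrent N i z; ∀ b : Fin N, b.val + 1 < N → ∀ s : ℝ, 0 < s → s ≤ 1 → |schur (s / 2) (P.bondCurrent N b) J - schur s (P.bondCurrent N b) J| ≤ C * s ^ θ

/-- **`UnitFrequencyBound`.**  An `N`-uniform bound on the orthogonal bond response at the FIXED frequency `s = 1`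
(a finite-time-window quantity; `N`-local by finite speed of propagation — size M/L, not the crux). -/
def UnitFrequencyBound : Prop :=
  ∀ ω₂ lam β γ : ℝ, 0 < ω₂ → 0 < lam → 0 < β → 0 < γ → ∀ T : ℝ, 0 < T → ∃ B : ℝ, ∀ N : ℕ, 2 ≤ N → let P := Literature.MathematicalPhysics.KineticTheory.HeatConduction.pinnedChain ω₂ lam β γ; let X := Literature.MathematicalPhysics.KineticTheory.HeatConduction.PhaseSpace N; let μ : MeasureTheory.Measure X := P.gibbsMeasure N T; let corr : (X → ℝ) → (X → ℝ) → ℝ → ℝ := fun f g t => (∫ z, f z * (∫ y, g y ∂(P.transitionKernel N T T t.toNNReal z)) ∂μ) - (∫ z, f z ∂μ) * (∫ z, g z ∂μ); let lap : ℝ → (X → ℝ) → (X → ℝ) → ℝ := fun s f g => ∫ t in Set.Ioi (0 : ℝ), Real.exp (-(s * t)) * corr f g t; let e : Fin N → X → ℝ := fun x z => z.2 x ^ 2 / 2 + P.U (z.1 x) + ∑ j : Fin N, ((if j.val = x.val + 1 then P.V (z.1 j - z.1 x) / 2 else 0) + (if x.val = j.val + 1 then P.V (z.1 x - z.1 j)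 / 2 else 0)); let G : ℝ → Matrix (Fin N) (Fin N) ℝ := fun s => Matrix.of fun x y => lap s (e x) (e y); let schur : ℝ → (X → ℝ) → (X → ℝ) → ℝ := fun s f g => lap s f g - ∑ x : Fin N, ∑ y : Fin N, lap s f (e x) * (G s)⁻¹ x y * lap s (e y) g; let J : X → ℝ := fun z => ∑ i : Fin N, P.bondCurrent N i z; ∀ b : Fin N, b.val + 1 < N → |schur 1 (P.bondCurrent N b) J| ≤ B

/-- **`SchurBulkLimitAtFixedFrequency`** (regime split D4, piece 1).  At each FIXED `s > 0` the orthogonal bond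
response is bulk-homogeneous uniformly in `N` (thermodynamic limit at positive Abel parameter: the Schur-complement
twin of `StaticAbelianSqueeze.ResolventSqueeze`, stmt-13417; size L, not the crux). -/
def SchurBulkLimitAtFixedFrequency : Prop :=
  ∀ ω₂ lam β γ : ℝ, 0 < ω₂ → 0 < lam → 0 < β → 0 < γ → ∀ T : ℝ, 0 < T → ∀ s : ℝ, 0 < s → ∃ K : ℝ, ∀ ε : ℝ, 0 < ε → ∃ R : ℕ, ∀ N : ℕ, 2 ≤ N → let P := Literature.MathematicalPhysics.KineticTheory.HeatConduction.pinnedChain ω₂ lam β γ; let X := Literature.MathematicalPhysics.KineticTheory.HeatConduction.PhaseSpace N; let μ : MeasureTheory.Measure X := P.gibbsMeasure N T; let corr : (X → ℝ) → (X → ℝ) → ℝ → ℝ := fun f g t => (∫ z, f z * (∫ y, g y ∂(P.transitionKernel N T T t.toNNReal z)) ∂μ) - (∫ z, f z ∂μ) * (∫ z, g z ∂μ); let lap : ℝ → (X → ℝ) → (X → ℝ) → ℝ := fun s f g => ∫ t in Set.Ioi (0 : ℝ), Real.exp (-(s * t)) * corr f g t; let e : Fin N → X → ℝ := fun x z =>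 z.2 x ^ 2 / 2 + P.U (z.1 x) + ∑ j : Fin N, ((if j.val = x.val + 1 then P.V (z.1 j - z.1 x) / 2 else 0) + (if x.val = j.val + 1 then P.V (z.1 x - z.1 j) / 2 else 0)); let G : ℝ → Matrix (Fin N) (Fin N) ℝ := fun s => Matrix.of fun x y => lap s (e x) (e y); let schur : ℝ → (X → ℝ) → (X → ℝ) → ℝ := fun s f g => lap s f g - ∑ x : Fin N, ∑ y : Fin N, lap s f (e x) * (G s)⁻¹ x y * lap s (e y) g; let J : X → ℝ := fun z => ∑ i : Fin N, P.bondCurrent N i z; ∀ b : Fin N, R ≤ b.val → b.val + 2 + R ≤ N → |schur s (P.bondCurrent N b) J - K| ≤ ε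

/-- **S⁺₂ `ExponentialClampedLocality`.**  Exponential off-diagonal decay of the clamped memory kernel
`𝔎_N(0)_{bc} = lim schur_s(j_b, j_c)` with `N`-uniform constants.  Recorded as the natural "rigid" strengthening of
(K1); predicted FALSE for the anharmonic chain (pair-field `z⁻²` tails, card pair-field-feshbach-peel, j015230),
true only in the Gaussian-closed velocity-flip anchor. -/
def ExponentialClampedLocality : Prop :=
  ∀ ω₂ lam β γ : ℝ, 0 < ω₂ → 0 < lam → 0 < β → 0 < γ → ∀ T : ℝ, 0 < T → ∃ C ξ : ℝ, 0 < ξ ∧ ∀ N : ℕ, 2 ≤ N → let P := Literature.MathematicalPhysics.KineticTheory.HeatConduction.pinnedChain ω₂ lam β γ; let X := Literature.MathematicalPhysics.KineticTheory.HeatConduction.PhaseSpace N; let μ : MeasureTheory.Measure X := P.gibbsMeasure N T; let corr : (X → ℝ) → (X → ℝ) → ℝ → ℝ := fun f g t => (∫ z, f z * (∫ y, g y ∂(P.transitionKernel N T T t.toNNReal z)) ∂μ) - (∫ z, f z ∂μ) * (∫ z, g z ∂μ); let lap : ℝ → (X → ℝ) → (X → ℝ) → ℝ := fun s f g => ∫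 t in Set.Ioi (0 : ℝ), Real.exp (-(s * t)) * corr f g t; let e : Fin N → X → ℝ := fun x z => z.2 x ^ 2 / 2 + P.U (z.1 x) + ∑ j : Fin N, ((if j.val = x.val + 1 then P.V (z.1 j - z.1 x) / 2 else 0) + (if x.val = j.val + 1 then P.V (z.1 x - z.1 j) / 2 else 0)); let G : ℝ → Matrix (Fin N) (Fin N) ℝ := fun s => Matrix.of fun x y => lap s (e x) (e y); let schur : ℝ → (X → ℝ) → (X → ℝ) → ℝ := fun s f g => lap s f g - ∑ x : Fin N, ∑ y : Fin N, lap s f (e x) * (G s)⁻¹ x y * lap s (e y) g; let J : X → ℝ := fun z => ∑ i : Fin N, P.bondCurrent N i z; ∀ b c : Fin N, ∀ K : ℝ, Filter.Tendsto (fun s => schur s (P.bondCurrent N b) (P.bondCurrent N c)) (nhdsWithin (0 : ℝ) (Set.Ioi 0)) (nhds K) → |K| ≤ C * Real.exp (-|((b.val : ℝ) - c.val)| / ξ)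

/-- **`ShadowConcentration`** (Ward-dissolution split D2, piece 2).  The energy shadow of the total current,
`a_N = G(0)⁻¹ lap₀(e, J)` (WardDictionary W3: `ρ_b = T²D_N − Φ_b·a_N`), has `N`-uniform `ℓ¹` mass concentrated
within `R(ε)` of the two ends. -/
def ShadowConcentration : Prop :=
  ∀ ω₂ lam β γ : ℝ, 0 < ω₂ → 0 < lam → 0 < β → 0 < γ → ∀ T : ℝ, 0 < T → ∃ C : ℝ, ∀ ε : ℝ, 0 < ε → ∃ R : ℕ, ∀ N : ℕ, 2 ≤ N → let P := Literature.MathematicalPhysics.KineticTheory.HeatConduction.pinnedChain ω₂ lam β γ; let X := Literature.MathematicalPhysics.KineticTheory.HeatConduction.PhaseSpace N; let μ : MeasureTheory.Measure X := P.gibbsMeasure N T; let corr : (X → ℝ) → (X → ℝ) → ℝ → ℝ := fun f g t => (∫ z, f z * (∫ y, g y ∂(P.transitionKernel N T T t.toNNReal z)) ∂μ) - (∫ z, f z ∂μ) * (∫ z, g z ∂μ); let lap : ℝ → (X → ℝ) → (X → ℝ) → ℝ := fun s f g => ∫ t in Set.Ioi (0 : ℝ), Real.exp (-(s * t)) * corr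 f g t; let e : Fin N → X → ℝ := fun x z => z.2 x ^ 2 / 2 + P.U (z.1 x) + ∑ j : Fin N, ((if j.val = x.val + 1 then P.V (z.1 j - z.1 x) / 2 else 0) + (if x.val = j.val + 1 then P.V (z.1 x - z.1 j) / 2 else 0)); let G : ℝ → Matrix (Fin N) (Fin N) ℝ := fun s => Matrix.of fun x y => lap s (e x) (e y); let schur : ℝ → (X → ℝ) → (X → ℝ) → ℝ := fun s f g => lap s f g - ∑ x : Fin N, ∑ y : Fin N, lap s f (e x) * (G s)⁻¹ x y * lap s (e y) g; let J : X → ℝ := fun z => ∑ i : Fin N, P.bondCurrent N i z; let a : Fin N → ℝ := fun y => ∑ x : Fin N, (G 0)⁻¹ y x * lap 0 (e x) J; (∑ y : Fin N, |a y|) ≤ C ∧ (∑ y : Fin N, if R ≤ y.val ∧ y.val + 1 + R ≤ N then |a y| else 0) ≤ ε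

/-- The boundedness half of the lead's stub U1 (`stub_uniformBondResponse`), any-limit form. -/
def BondBoundAnyLimit : Prop :=
  ∀ ω₂ lam β γ : ℝ, 0 < ω₂ → 0 < lam → 0 < β → 0 < γ → ∀ T : ℝ, 0 < T → ∃ C : ℝ, ∀ N : ℕ, 2 ≤ N → let P := Literature.MathematicalPhysics.KineticTheory.HeatConduction.pinnedChain ω₂ lam β γ; let X := Literature.MathematicalPhysics.KineticTheory.HeatConduction.PhaseSpace N; let μ : MeasureTheory.Measure X := P.gibbsMeasure N T; let corr : (X → ℝ) → (X → ℝ) → ℝ → ℝ := fun f g t => (∫ z, f z * (∫ y, g y ∂(P.transitionKernel N T T t.toNNReal z)) ∂μ) - (∫ z, f z ∂μ) * (∫ z, g z ∂μ); let lap : ℝ → (X → ℝ) → (X → ℝ) → ℝ := fun s f g => ∫ t in Set.Ioi (0 : ℝ), Real.exp (-(s * t)) * corr f g t; let e : Fin N → X → ℝ := fun x z => z.2 x ^ 2 / 2 + P.U (z.1 x) + ∑ j : Fin N, ((if j.val = x.val + 1 then P.V (z.1 j - z.1 x) / 2 else 0) + (if x.val = j.val + 1 then P.V (z.1 x - z.1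 j) / 2 else 0)); let G : ℝ → Matrix (Fin N) (Fin N) ℝ := fun s => Matrix.of fun x y => lap s (e x) (e y); let schur : ℝ → (X → ℝ) → (X → ℝ) → ℝ := fun s f g => lap s f g - ∑ x : Fin N, ∑ y : Fin N, lap s f (e x) * (G s)⁻¹ x y * lap s (e y) g; let J : X → ℝ := fun z => ∑ i : Fin N, P.bondCurrent N i z; ∀ b : Fin N, b.val + 1 < N → ∀ ρ : ℝ, Filter.Tendsto (fun s => schur s (P.bondCurrent N b) J) (nhdsWithin (0 : ℝ) (Set.Ioi 0)) (nhds ρ) → |ρ| ≤ C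

/-! ### The bookkeeping S⁺₁ would contribute (proved) -/

/-- **Dyadic telescoping.**  If `|F 1| ≤ B`, `|F(s/2) − F(s)| ≤ C s^θ` on `(0,1]` with `θ > 0`, `C ≥ 0`, and
`F → ρ` as `s ↓ 0`, then `|ρ| ≤ B + C/(1 − 2^{−θ})`. -/
theorem abs_le_of_dyadic_modulus {F : ℝ → ℝ} {B C θ ρ : ℝ} (hθ : 0 < θ) (hC : 0 ≤ C)
    (h1 : |F 1| ≤ B)
    (hmod : ∀ s : ℝ, 0 < s → s ≤ 1 → |F (s / 2) - F s| ≤ C * s ^ θ)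
    (hlim : Filter.Tendsto F (nhdsWithin 0 (Set.Ioi 0)) (nhds ρ)) :
    |ρ| ≤ B + C / (1 - (1 / 2 : ℝ) ^ θ) := by
  set q : ℝ := (1 / 2 : ℝ) ^ θ with hq
  have hq0 : 0 ≤ q := Real.rpow_nonneg (by norm_num) θ
  have hq1 : q < 1 := Real.rpow_lt_one (by norm_num) (by norm_num) hθ
  have hx : ∀ n : ℕ, ((1 / 2 : ℝ) ^ n) ^ θ = q ^ n := by
    intro n
    rw [hq, ← Real.rpow_natCast (1 / 2 : ℝ) n, ← Real.rpow_mul (by norm_num : (0 : ℝ) ≤ 1 / 2), mul_comm,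
      Real.rpow_mul (by norm_num : (0 : ℝ) ≤ 1 / 2), Real.rpow_natCast]
  have hstep : ∀ n : ℕ, |F ((1 / 2 : ℝ) ^ n)| ≤ B + C * ∑ j ∈ Finset.range n, q ^ j := by
    intro n
    induction n with
    | zero => simpa using h1
    | succ n ih =>
      have hpos : (0 : ℝ) < (1 / 2 : ℝ) ^ n := by positivity
      have hle : (1 / 2 : ℝ) ^ n ≤ 1 := pow_le_one₀ (by norm_num) (by norm_num)
      have hm := hmod _ hpos hle
      rw [hx n] at hm
      have heq : (1 / 2 : ℝ) ^ (n + 1) = (1 / 2 : ℝ) ^ n / 2 := by rw [pow_succ]; ring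
      rw [heq, Finset.sum_range_succ]
      have htri := abs_sub_abs_le_abs_sub (F ((1 / 2 : ℝ) ^ n / 2)) (F ((1 / 2 : ℝ) ^ n))
      nlinarith [htri, ih, hm]
  have hgeom : ∀ n : ℕ, ∑ j ∈ Finset.range n, q ^ j ≤ 1 / (1 - q) := by
    intro n
    have hs := hasSum_geometric_of_lt_one hq0 hq1
    have h := sum_le_hasSum (Finset.range n) (fun i _ => pow_nonneg hq0 i) hs
    simpa [one_div] using h
  have hbound : ∀ n : ℕ, |F ((1 / 2 : ℝ) ^ n)| ≤ B + C / (1 - q) := by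
    intro n
    calc |F ((1 / 2 : ℝ) ^ n)| ≤ B + C * ∑ j ∈ Finset.range n, q ^ j := hstep n
      _ ≤ B + C * (1 / (1 - q)) := by
          have := mul_le_mul_of_nonneg_left (hgeom n) hC
          linarith
      _ = B + C / (1 - q) := by ring
  have hseq : Filter.Tendsto (fun n : ℕ => (1 / 2 : ℝ) ^ n) Filter.atTop (nhdsWithin 0 (Set.Ioi 0)) := by
    refine tendsto_nhdsWithin_iff.2 ⟨tendsto_pow_atTop_nhds_zero_of_lt_one (by norm_num) (by norm_num), ?_⟩
    exact Filter.Eventually.of_forall fun n => Set.mem_Ioi.2 (by positivity)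
  have hF : Filter.Tendsto (fun n : ℕ => |F ((1 / 2 : ℝ) ^ n)|) Filter.atTop (nhds |ρ|) := (hlim.comp hseq).abs
  exact le_of_tendsto' hF hbound

/-- **What S⁺₁ buys (and no more).**  `UnitFrequencyBound ∧ UniformSchurModulus` give the BOUNDEDNESS half of U1
(any-limit form) with the explicit constant `B + C/(1 − 2^{−θ})`.  The homogeneity half would additionally use
`SchurBulkLimitAtFixedFrequency` (Moore–Osgood exchange of `s ↓ 0` and `N → ∞`).  The census explains why the
modulus hypothesis is not easier than the crux: restricted to windows `1/s ≲ N/v` it is a decay RATE for the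
infinite-volume current autocorrelation (FourierGreenKubo's rank-2 crux stmt-0703 with a rate). -/
theorem bondBound_of_unitFrequency_of_modulus :
    UnitFrequencyBound → UniformSchurModulus → BondBoundAnyLimit := by
  intro hU hM ω₂ lam β γ hω hl hβ hγ T hT
  obtain ⟨B, hB⟩ := hU ω₂ lam β γ hω hl hβ hγ T hT
  obtain ⟨C, θ, hθ, hCθ⟩ := hM ω₂ lam β γ hω hl hβ hγ T hT
  refine ⟨B + max C 0 / (1 - (1 / 2 : ℝ) ^ θ), fun N hN => ?_⟩
  intro P X μ corr lap e G schur J b hb ρ hρ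
  have h1 : |schur 1 (P.bondCurrent N b) J| ≤ B := hB N hN b hb
  have hmod : ∀ s : ℝ, 0 < s → s ≤ 1 →
      |schur (s / 2) (P.bondCurrent N b) J - schur s (P.bondCurrent N b) J| ≤ max C 0 * s ^ θ :=
    fun s hs hs1 => (hCθ N hN b hb s hs hs1).trans
      (mul_le_mul_of_nonneg_right (le_max_left _ _) (Real.rpow_nonneg hs.le θ))
  exact abs_le_of_dyadic_modulus (F := fun s => schur s (P.bondCurrent N b) J) hθ (le_max_right _ _) h1 hmod hρ

end Summit.AtomisticToContinuum.FouriersLaw.Cruxes.OrthogonalOhm.StrategyCensus
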